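import Mathlib
import HarnessLib
import HarnessLib.Audit
import Summits.ValiantsHypothesis.Statement
import Literature.Computability.AlgebraicComplexity.ValiantConjectureEquivProofs
import HarnessLib.Audit.Status.Attr

/-!
Route: SymmetroidDescartes

DORMANT since 2026-08-24T12:42:25Z (reconciler: no traction for 6.8 d (last activity item-evidence-added at 2026-08-17T17:28:16Z); parked, not closed — `ledger route dormant route-ValiantsHypothesis-SymmetroidDescartes --off` to reactiv) — unstaffed, not closed; items shared with open routes are served there. `ledger route dormant <id> --off` reactivates.

# Route SymmetroidDescartes — Matrix Descartes rule — lacunary symmetric determinants alternate at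
most K^(bK) times, by Rolle induction on the number of terms

STRENGTHEN-TO-INDUCT (lens 3.11), realising card lacunary-symmetroid-descartes. It suffices to show
X = LacunaryDescartes, a
matrix Descartes rule: there is b such that for every c, for all large K and every size m ≤
2^(c·(log₂K+1)²), the determinant of a
K-term LACUNARY SYMMETRIC PENCIL F(t) = Σ_{l<K} t^(d_l)·S_l (S_l real symmetric m×m, arbitrary
exponents d_l ∈ ℕ) has at most K^(bK)
strict sign alternations on (0,∞) — where Descartes' monomial count only gives (m+K)^K =
2^(Θ(c·K·log²K)). X is STRONGER than VH in
the direction that matters and decides it by inversion: if VP_ℂ = VNP_ℂ then PER is p-computable,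
Tavenas's P-definable theta family
(tree: `Tavenas2014_cor_3_37`, `tavenasV`, grouped into base-B digits) lies in VP, hence (VP ⊆
VQP-det, GKKP symmetrisation,
realification — all in tree) its restriction to a lacunary monomial curve IS such a pencil
determinant, in the regime, with more than
K^(bK) alternations (support ThetaPencilWitness) — contradiction. INDUCTION VARIABLE: K, the number
of lacunary terms; the INDUCTIVE
STEP is the rank-2 crux DerivedPencilRolleQuasi (Rolle against the derived (K−1)-term pencil ∂F =
d/dt(t^(−d₀)F), with budget
(K+1)^(A·K)·2^((log₂m+2)^A): Descartes-like in the number of terms, quasi-polynomial in the size) —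
the hypothesis of the deciding
theorem, from which X (crux rank 3) is DERIVED inside `closes` through the glue support
QuasiRolleToDescartes (iteration +
perturbation + regime arithmetic). REV 2/5: the rev-1 step DerivedPencilRolle (polynomial budget
(m+K)^a) is FALSE — on the triangular/ABP class the derived
determinant never vanishes on (0,∞), so the step would be a polynomial real-root bound for skew
circuits over lacunary monomials,
violated by parametric-shortest-path families (n^(Ω(log n)) breakpoints + a convexity bump:
2^(Θ(log² m)) roots) and by the
staircase family (m^((K−1)/6) roots at O(1) terms), which formally REFUTES it
(`Theorems.SymmetroidDescartes.not_DerivedPencilRolle`,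
2026-08-17; want dropped at rev 5, record kept below); old ⇒ new, nothing proved is lost. Both
mechanisms are capped at
2^(O(log² m)) (Gusfield): inside the new budget, and ≤ 2^(O(c² log⁴K)) ≪ K^(bK) in X's regime.
Lean: `∃ b : ℕ, ∀ c : ℕ, ∃ K₀ : ℕ, ∀ K ≥ K₀, ∀ m : ℕ, m ≤ 2 ^ (c * (Nat.log 2 K + 1) ^ 2) → ∀ (S :
Fin K → Matrix (Fin m) (Fin m) ℝ) (d : Fin K → ℕ), (∀ l, (S l).IsSymm) → ∀ (N : ℕ) (τ : Fin (N + 1)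
→ ℝ), StrictMono τ → (∀ j, 0 < τ j) → (∀ j : Fin N, ((∑ l, (Polynomial.X : Polynomial ℝ) ^ d l • (S
l).map Polynomial.C).det).eval (τ j.castSucc) * ((∑ l, (Polynomial.X : Polynomial ℝ) ^ d l • (S
l).map Polynomial.C).det).eval (τ j.succ) < 0) → N ≤ K ^ (b * K)`

## Assembly
Pure logic over one tree theorem: `perNotPComputableComplex_iff_holds` (¬ p-computable PER ↔ VP_ℂ ≠
VNP_ℂ). The repaired inductive
step DerivedPencilRolleQuasi and the glue QuasiRolleToDescartes give X = LacunaryDescartes (derived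
in-cone: `have hX : LacunaryDescartes := h₂ h₁`).
Assume VP_ℂ = VNP_ℂ; then PER is p-computable; ThetaPencilWitness (proved,
`ThetaPencilWitness_proof`) with the b of X yields c; X (with
that c) yields K₀; the witness yields K ≥ K₀ and a pencil in the regime with K^(bK)+1 alternations;
X bounds them by K^(bK); omega.
The deciding theorem `closes (h₁ : DerivedPencilRolleQuasi) (h₂ : QuasiRolleToDescartes) (h₃ :
ThetaPencilWitness) : ValiantsHypothesis`
is 12 lines and elaborates (planner Sketch.lean rc 0, native audit); cone =
{DerivedPencilRolleQuasi, QuasiRolleToDescartes, LacunaryDescartes,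
ThetaPencilWitness}; the rev-1 items DerivedPencilRolle (REFUTED) and RolleToDescartes (proved rev-1
glue, template of the new one) were dropped
from the wants at rev 5 (records kept below); Assembly is restated to this chain (`assembly_proof` =
`closes h₁ h₂ h₃` elaborates
again); QuasiRolleToDescartes is PROVED.

Rationale: WHY THIS LINE. Koiran's real τ-programme (Koiran2011 §6; KoiranPortierTavenas2015; Tavenas2014 §2.2)
bounds real zeros of depth-4 sums of products of
sparse polynomials and transfers to constant-free lower bounds; here the bounded class is switched
to SKEW circuits = (by
GrenetEtAl2011 Thm 4/5, in tree as `GKKP2011_detPoly_symmetric_holds`) lacunary SYMMETRIC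
determinantal pencils, which (i) closes to
full VP_ℂ ≠ VNP_ℂ with constants free (VP ⊆ VQP-det and ℂ→ℝ simulation are tree theorems; the
quasi-polynomial size is absorbed by the
regime log m ≤ c·log²K) and (ii) imports spectral theory of self-adjoint pencils: real
eigen-branches with Hellmann–Feynman
derivatives u^T ∂F u, Cauchy interlacing under compression, Loewner monotonicity on definite
stretches, and the de Gua–Rolle induction
on the number of terms that PROVES the matrix Descartes rule for hyperbolic pencils with definite
coefficients (CameronPsarrakos2019
Lemma 2, Thm 3; conjecture (6) there for all definite-coefficient self-adjoint matrix polynomials).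
No prior route counts real roots
or sign alternations for a skew class (NewtonUnitEquations/NewtonFrames are valuative on SPS,
TauConst counts integer roots
constant-free, FeketeSOS counts SOS supports, SymPencil uses symmetric pencils only for sdc lower
bounds); the negatives index
(NoTightInfinity, ElusiveCandidate, OptimalUnique/Three) is untouched. REV 2 (route-choice
2026-08-17). The rev-1 inductive step DerivedPencilRolle (polynomial budget) is refuted on paper by
two independent constructions found inside this route (triangular/ABP symmetrisation +
parametric-shortest-path breakpoints, Carstensen1983 / MulmuleyShah2001 / GajjarRadhakrishnan2019,
realised by a convexity bump; and the staircase family) — the first genuine ROOT-AMPLIFICATION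
mechanisms for skew circuits over lacunary monomials recorded in the tree; both saturate at
2^(Θ(log² m)) (Gusfield's n^(log n+O(1)) cap on breakpoints), which is exactly what the repaired
step DerivedPencilRolleQuasi allows and far below what X forbids in its regime. The line (Rolle
induction on the number of terms, X = LacunaryDescartes) is unchanged; only the per-step budget
moved from poly(m+K) to K^(O(K))·2^(polylog m), the weakest natural budget the iteration absorbs.
REV 5 (route-repair 2026-08-17): the formal refutation `not_DerivedPencilRolle` landed; the rev-1
wants (DerivedPencilRolle, RolleToDescartes) are dropped, Assembly restated to the rev-2 chain,
QuasiRolleToDescartes proved — the open content is exactly the two cruxes #2 DerivedPencilRolleQuasi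
and #3 LacunaryDescartes (the latter now DERIVED from #2 by the proved glue).

RANKED CRUXES. #2 DerivedPencilRolleQuasi (crux) — THE REPAIRED INDUCTIVE STEP on the number of
terms (K+1 → K): there are constants C, A such that for every size m, every (K+1)-term pencil F =
Σ_{l≤K} X^(d_l)•S_l with S_l real symmetric INVERTIBLE and d strictly increasing has Z₊(det F) ≤
C·Z₊(det ∂F) + (K+1)^(A·K)·2^((log₂m+2)^A), where ∂F = Σ_{l≥1}(d_l−d₀)·X^(d_l−d₀−1)•S_l is the
derived K-term pencil (same class) and Z₊ counts distinct positive roots. Budget = Descartes-like in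
the number of terms × quasi-polynomial in the size: the weakest natural slack the glue absorbs (≤
K^(O(K)) whenever log₂m ≤ c(log₂K+1)²) and the shape forced by the refutation of the old step (on
the triangular/ABP class Z₊(∂F) = 0, tree `triangular_bound_of_pencilBound`, so any budget is an
absolute real-root bound for skew circuits over K+1 lacunary monomials; tropical-bump families reach
2^(Θ(log² m)), the staircase reaches m^((K−1)/6) at O(1) terms; both ≤ 2^(O(log² m))). Old ⇒ new
(`derivedPencilRolleQuasi_of_derivedPencilRolle`, planner Sketch.lean, A = a+1), so the proved
sectors transfer: m ≤ 1 (tree `base_of_constants`), two terms (≤ m), commuting (mK),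
definite-hyperbolic (CameronPsarrakos2019 Lemma 1), m = 2 (KoiranPortierTavenas2015 Thm 12). Content
regime A'·log₂m < K < (2em)^(1/(A+1)) (K = O(log m) is free by the Descartes count C(m+K,K) ≤ 2^(K
log₂(2em/K)); for K ≳ m^(1/(A+1)) the budget exceeds that count) — few-but-not-logarithmically-few
distinct monomials, containing the route's regime K ≈ 2^√(log₂m/c); it does NOT imply a real-τ bound
for ΣΠΣ. [difficulty: XL / open] (why it might fail: a root-amplification mechanism in skew circuits
over few lacunary monomials beyond tropical breakpoints — multi-scale bumps, or cancellation among
signed paths — giving 2^((log m)^ω(1)) positive roots with Z₊(∂F)=0 kills it for every A.)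
[CameronPsarrakos2019, KoiranPortierTavenas2015, GajjarRadhakrishnan2019, MulmuleyShah2001,
Carstensen1983, Koiran2011, Khovanskii1991]
#3 LacunaryDescartes (crux) — LACUNARY MATRIX DESCARTES RULE (card K1 in the form the assembly
needs, alternation currency): ∃ b ∀ c ∃ K₀ ∀ K ≥ K₀ ∀ m ≤ 2^(c(log₂K+1)²), for all real symmetric
S_0..S_{K−1} (m×m) and exponents d : Fin K → ℕ, every strictly increasing positive sequence τ_0 < …
< τ_N with det F(τ_j)·det F(τ_{j+1}) < 0 for all j (F = Σ_l X^(d_l)•S_l) has N ≤ K^(bK). Trivial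
bound (Descartes on ≤ C(m+K−1,K−1) monomials) is 2^(Θ(cK log²K)); commuting/definite/hyperbolic
sectors give ≤ m(K−1)+1; the two amplification mechanisms now in the tree (tropical bump, staircase)
give at most 2^(O(c² log⁴K)) in the regime. [deps: none; derived in-cone from #2 via
QuasiRolleToDescartes] [difficulty: open-problem] (why it might fail: indefinite S_l may let one
eigen-branch wind super-exponentially in K: a poly(j)-size, poly(j)-term symmetric lacunary pencil
computing T_{2^j}-like compositions WITHOUT size ≥ degree, or a root-amplification mechanism beyond
tropical breakpoints iterated across K ≫ log m scales, would exceed K^(bK).) [CameronPsarrakos2019,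
Koiran2011, KoiranPortierTavenas2015, Khovanskii1991, GrenetEtAl2011, Tavenas2014,
GajjarRadhakrishnan2019]
#9 QuasiRolleToDescartes (support, PROVED `quasiRolleToDescartes_proof` @dfc95003) — GLUE for the
repaired engine: DerivedPencilRolleQuasi → LacunaryDescartes. Template = the landed
`rolleToDescartes_proof` (Theorems/SymmetroidDescartesRolleToDescartes.lean): iterate the step K
times (budget monotone in K; one-term base has no positive root) ⇒ Z₊ ≤
(K+1)·C'^K·(K+1)^(A·K)·2^((log₂m+2)^A), C' = max C 1; merging of equal exponents + perturbation S_l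
↦ S_l+ηI off the spectra + IVT at the N+1 test points verbatim
(`alternations_le_of_derivedPencilRolle`); new regime arithmetic: m ≤ 2^(c(log₂K+1)²) ⇒ (log₂m+2)^A
≤ ((c+2)(log₂K+1)²)^A ≤ K for K ≥ K₀(c,A), so 2^((log₂m+2)^A) ≤ 2^K ≤ K^K, (K+1)^(A·K) ≤ K^(2A·K),
K·C'^K ≤ K^((C'+1)K) ⇒ b = C'+2A+3 (depends on C, A only). [difficulty: M] [Khovanskii1991,
arXiv:1205.1015]
#9 ThetaPencilWitness (support, PROVED `ThetaPencilWitness_proof` @3ec91464) — THETA MONSTER IN THE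
CLASS: if PER is p-computable over ℂ then for every b there is c such that for every K₀ some K ≥ K₀
admits a K-term real symmetric pencil of size m ≤ 2^(c(log₂K+1)²) whose determinant has ≥ K^(bK)+1
strict sign alternations on (0,∞) (Tavenas2014 Cor. 3.37 digit-grouped, realified, GKKP-symmetrised,
restricted to a lacunary monomial curve). [Tavenas2014, GrenetEtAl2011, HrubesYehudayoff2011,
Burgisser2000, KoiranEtAl2014]
RECORDS (rev-1 items whose wants were DROPPED at rev 5 — route-repair 2026-08-17; rendered below as
`earlier …` lines, out of the cone of `closes` since rev 2): DerivedPencilRolle (stmt-18500, rev-1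
rank-2 step, polynomial budget (m+K)^a) — REFUTED by
`Theorems.SymmetroidDescartes.not_DerivedPencilRolle` @6926a673794b
(SymmetroidDescartesDerivedPencilRolleRefutation.lean; class substantive for the polynomial budget,
misstated relative to the line: the repaired successor is #2): the STAIRCASE family — layered graphs
with (2^L−1)(n+1) layers on 2^L·n·2 vertices and L+1 exponent classes whose path polynomial has a
unique dominant walk of sign (−1)^j at n^L increasing test points (a mirror-free Carstensen1983 /
MulmuleyShah2001 parametric-shortest-path bound with O(L) slope classes), the path determinant det(I
− Z₀ − W·u vᵀ) = 1 − W·P and GKKP symmetrisation give symmetric pencils with K = L+2 terms, size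
4m₀³+7, n^L − 1 alternations, beating K·C^K·(m+K)^a (`alternations_le_of_derivedPencilRolle`) for L
= 6a+1 and even n large; earlier refuted on paper (Cruxes/DerivedPencilRolle/Disproof.lean §A–§C:
tropical bump on GajjarRadhakrishnan2019 DAGs, negative lemma
`derivedPencilRolle_false_of_triangularClassManyRoots`). In the negatives index; never re-wanted.
RolleToDescartes (stmt-18503, PROVED `rolleToDescartes_proof` @514c2ecd: DerivedPencilRolle →
LacunaryDescartes; the template of QuasiRolleToDescartes) — dropped with its refuted antecedent.
Assembly — RESTATED at rev 5 (stmt-18504 → its successor) from the rev-1 chain to the rev-2 chain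
DerivedPencilRolleQuasi → QuasiRolleToDescartes → ThetaPencilWitness → VH, literally the type of
`closes`, so that its tree proof `assembly_proof := closes h₁ h₂ h₃`
(Theorems/SymmetroidDescartesAssembly.lean, broken since the rev-2 re-glue) elaborates again
verbatim. BUILD REPAIR PENDING (Theorems-side only; route-choice 2026-08-17T11:5xZ supersedes the g3
recipe): TWO root modules import this route file and still name the dropped decls —
Theorems/SymmetroidDescartesRolleToDescartes.lean (`DerivedPencilRolle` ll.118/164,
`…Theses.SymmetroidDescartes.RolleToDescartes` l.371) and
Theorems/DerivedPencilRolle/Negative/DerivedPencilRolleUniformStep.lean (`derivedPencilRolle_iff :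
DerivedPencilRolle ↔ … := Iff.rfl`, l.56 — so the restore must be a plain `def` with the VERBATIM
body); both rc 1 `Unknown identifier`, blocking 8 importers:
SymmetroidDescartesQuasiRolleToDescartes (= `quasiRolleToDescartes_proof`, the proof of the live
glue #9), SymmetroidDescartesDerivedPencilRolleRefutation (`not_DerivedPencilRolle`),
DerivedPencilRolle/Negative/{FalseOfTriangularClassManyRoots, IndefiniteWitness, BumpLemma},
MatrixDescartes/Negative/MatrixDescartesWitness24 and LacunarySymmetroidMatrixDescartesStubNegRoots
(route LacunarySymmetroid). FIX = in-place record, precedent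
Theorems/UlrichPaddedNoTightInfinityRefutation.lean ll.46–61; two mechanical proposals, no new
module, no statement or proof changed: (1) whole-file resubmission of
Theorems/SymmetroidDescartesRolleToDescartes.lean with a block `namespace
Summit.ValiantsHypothesis.ValiantsHypothesis.Theses.SymmetroidDescartes … def DerivedPencilRolle :
Prop := <stmt-18500 verbatim> (docstring: RECORD, FALSE, refuted by not_DerivedPencilRolle) … def
RolleToDescartes : Prop := DerivedPencilRolle → LacunaryDescartes … end` inserted after `set_option
linter.dupNamespace false` — READY file `SymmetroidDescartesRolleToDescartes.lean` (+
`RolleToDescartes.records.diff`) attached as evidence on this route and on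
defn-SymmetroidDescartesDerivedPencilRolleRecord (lean check rc 0 / 0 warnings; scratch chains with
the UniformStep, Refutation and QuasiRolleToDescartes bodies rc 0; audit advisory
`tree.vendored-fact` on the record only); propose it `--supports stmt-ValiantsHypothesis-18065` or
`--workitem fix:…SymmetroidDescartesRolleToDescartes`; (2) then in
Theorems/DerivedPencilRolle/Negative/DerivedPencilRolleUniformStep.lean replace `import
….Theses.SymmetroidDescartes` by `import
Summits.ValiantsHypothesis.ValiantsHypothesis.Theorems.SymmetroidDescartesRolleToDescartes`
(`UniformStep.import.diff`; no cycle). The g2/g3 Record-MODULE kit on the defn item is equivalent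
but needs the module plus an import line in EACH root (three proposals). WHO: a migration prover
(the next periodic full build files `fix:<module>` migrate items for both roots, gate.md §5), any
prover on this route's open items (land (1)+(2) first, `--supports stmt-ValiantsHypothesis-18065`),
or the operator (who should also archive the stale payload.broken record of the dropped stmt-18500).
NOT reachable from role planner: Theorems are prover-only, `workitem add --kind migrate` is refused,
and the decls cannot return route-side — an active refuted item re-BREAKS the route and is refused
by the negatives index, and the gate renders the glue as ONE theorem only (record defs in
`--closes-file` are rejected: verified 2026-08-17T11:3xZ).

TWO-LAYER PLAN. Foreseen glued split of the rank-3 crux X: LacunaryDescartes ⇐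
DerivedPencilRolleQuasi → StubIterate (iteration with the (K+1)^(AK)·2^((log₂m+2)^A) budget + regime
arithmetic) → StubPerturb (merging/perturbation/IVT, landed inside
`alternations_le_of_derivedPencilRolle`) → LacunaryDescartes — filed as the support
QuasiRolleToDescartes, consumed by `closes`. For the rank-2 crux NO m-induction with uniform
constants (tree `not_uniform_step`: every "same constants for all constants" bordering step is
false; for fixed constants it is the crux): the foreseen lines are (a) TROPICAL COMPARISON — bound
Z₊ on the triangular/ABP class by the breakpoint count of the tropicalisation times 2^(polylog)
(Gusfield-type n^(O(log n)) upper bound for parametric path optima is the model; the new object is a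
sign-aware Maslov dequantisation error term), then reduce invertible symmetric pencils to signed
ABPs by `det` expansion along a Hessenberg normal form; (b) FEW TERMS ARE FREE — for K ≤ A'·log₂m
the Descartes monomial count C(m+K,K) ≤ 2^(K·log₂(2em/K)) ≤ 2^(A'·log₂m·log₂(2em)) is inside the
budget (A ≥ A'+2), and for K ≥ (2em)^(1/(A+1)) the factor (K+1)^(A·K) alone exceeds it: the content
regime is A'·log m < K < (2em)^(1/(A+1)), where the induction on K must show that each derivation
loses at most budget-many roots; (c) the Rolle term proper only on definite stretches of ∂F (Loewner
monotone ⇒ ≤ m zeros per stretch, tree SkelVet `SemidefiniteCase` material). Alternative engine in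
reserve: eigenframe variation-diminishing via Res_λ(det(F−λ), tr(adj(F−λ)·∂F)) and the
cancellation-free Birkhoff-shadow bound Z_trop(m,K).

KILL CRITERIA. Refutation of LacunaryDescartes (an explicit family of symmetric lacunary pencils in
the regime with > K^(bK) alternations for every b — e.g. Chebyshev T_{2^j} as a poly(j)-size
poly(j)-term symmetric lacunary determinant, or an amplification mechanism giving 2^(2^(Ω(√(log
m)))) roots at K = 2^(√(log m/c)) terms) closes the route `refuted:LacunaryDescartes` and retires
every real-root programme for skew classes. Refutation of DerivedPencilRolleQuasi (needs 2^((log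
m)^ω(1)) positive roots from poly-size skew circuits over FEW lacunary monomials with Z₊(∂F) = 0,
i.e. amplification beyond tropical breakpoints) BREAKS the route (hypothesis of `closes`) but not
the thesis unless it also reaches X's scale: repair = budget 2^(2^((log₂m)^θ)), θ < 1/2 (still
absorbed: anything 2^(2^(o(√log m))) is) or re-engine over X alone (needs-human: one-crux route).
The formal refutation of the rev-1 step DerivedPencilRolle (`not_DerivedPencilRolle`, staircase
line, 2026-08-17T08:09Z) touched nothing in the cone of `closes`; the route-broken event it raised
was answered at rev 5 by dropping the wants of DerivedPencilRolle and RolleToDescartes and restating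
Assembly (REPAIRED). VH proved by any other route moots the line; a proof of Cameron–Psarrakos (6)
does NOT (definite coefficients only); a proof of Koiran's real τ-conjecture does NOT (ΣΠΣ, not skew
over few monomials).

NOT DECOMPOSED YET. The sign-aware dequantisation error term of line (a) (how far real roots of a
signed ABP over K+1 monomials can exceed the breakpoints of its tropicalisation — the new quantity
the repaired crux is really about), the Hessenberg/`det`-expansion reduction from invertible
symmetric pencils to signed ABPs with controlled K, the exact constants (C, A, b), the perturbation
radius in StubPerturb (landed), — layer-2 / prover work, deliberately not items (the Lean port of
`rolleToDescartes_proof` to the new budget has LANDED: `quasiRolleToDescartes_proof`). Birth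
skeleton for DerivedPencilRolleQuasi: NOT registered by this (route-choice) seat; the
crux-ideate/crux-plan chain re-arms on the new item with Disproof.lean as its first input.

CHEAPEST FALSIFIER. (i) Realise T_{2^j} (τ = O(j), 2^(j−1) positive roots) — or any degree-2^(O(j))
real polynomial with 2^j positive roots — as det Σ_{l<K} t^(d_l) S_l with real symmetric S_l of size
m = poly(j) and K = poly(j) terms: kills LacunaryDescartes outright (diagonal, block, companion,
Horner towers, Sylvester resultants, ABP concatenations of T_2∘⋯∘T_2 all keep size ≥ degree/K). (ii)
For DerivedPencilRolleQuasi: ITERATE THE BUMP — take the Gajjar–Radhakrishnan DAG Φ(1,0,⌊log n⌋)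
(n^(⌊log n⌋) breakpoints on ≤ 6n⁸ vertices), form the bump f = f_A² − e^(−Λη/2) f_A(e^η t)
f_A(e^(−η) t) (tree `two_mul_le_card_posRoots_bumpPoly`: 2N roots), and ask whether a SECOND
tropical layer (using f, which is no longer positive, as an edge label inside another
parametric-shortest-path DAG, or bumps at two scales Λ₁ ≪ Λ₂) multiplies rather than adds root
counts: any family with 2^(ω(log² m)) positive roots over K = O(log m)… few monomials is the seed
that kills #2 (compute: extend compute/bump_realisation.py of j023449; exact rational sign tests).
(iii) RUN so far (j021881, j022930/j022946, j023449): small formats saturate at the parameter count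
Π(m,T) ≤ Descartes (M(2,3)=5, M(3,3)=9, M(2,4)≥7); tropical families show exactly 2N alternations as
predicted; nothing super-quasi-polynomial is known in any skew model.

NUMBERS. Descartes/monomial bound: alternations ≤ C(m+K−1,K−1)−1, i.e. 2^(Θ(cK·log²K)) at m = 2^(c
log²K) (Grabiner 1999: sharp for generic
supports). Claimed: ≤ K^(bK) = 2^(bK log₂K). Proved sectors (card, CameronPsarrakos2019 Thm 3/7,
Lemma 6): K = 2 ⇒ ≤ m; all S_l (l≥1)
PSD ⇒ ≤ m; definite-hyperbolic ⇒ ≤ m·α ≤ m(K−1); commuting ⇒ ≤ m(K−1); m = 2 ⇒ poly(K)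
(KoiranPortierTavenas2015 Thm 12 with k = 3
squares). Witness: Tavenas V_ν has exactly 2^ν−1 real roots (tree
`card_roots_toFinset_map_tavenasV`), grouped into K = n_y+1 ≈
2ν/((2b+1)log₂ν) terms ⇒ alternations 2^ν = K^((2b+1+o(1))K/2·…) > K^(bK)+1; regime constant c =
208A²+O(1) from
`determinantalComplexity_le_two_pow` (dc ≤ 2^(17E²)) and GKKP (4m³+7). Small formats (j021881): max
alternations found (2,3):4,
(3,3):5, (4,3):5, (6,3):9, (8,3):10, (3,4):6, (4,4):7, (6,4):11, (8,4):11. REV 2: refuting families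
of the old step — tropical bump on Mulmuley–Shah/Gajjar–Radhakrishnan graphs G(1,0,m) (j023449):
(n,m) = (4,1): 5 pieces / 8 alternations; (4,2): 29 / 56; (4,3): 160 / 318 (209 nodes, K = 29
slopes); (5,2): 41 / 80; (5,3): 265 / 528 (251 nodes, K = 36); asymptotically N = n^(Θ(log n)) on
poly(n) nodes, capped by n^(log n+O(1)) (Gusfield). Staircase (Lines/staircase-refutation.md,
validated n ∈ {2,4,6}, L ≤ 4): K+1 = L+2 terms, N = n^L − 1 alternations, size m =
4((2^L−1)(n+1)+1)³(2^(L+1)n)³+7 ≤ 2^(6L+12)n^6, so Z₊ ≈ m^(L/6) ≤ 2^(log² m/36). New budget at A =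
3: IndefiniteWitness (m=2,K=3): 6 ≤ 4^9·2^27; nine-root secular (m=3,K=3): 9 ≤ budget; commuting mK,
N0 2K: trivially inside; staircase n^L vs ≥ 2^((6log₂n+6L)³); bump 2n^(κ log n) (κ ≤ 1+o(1)) vs
2^((log₂n+5)³). Absorption: log₂m ≤ c(log₂K+1)² ⇒ budget ≤ K^(2AK)·2^(((c+2)(log₂K+1)²)^A) ≤
K^((2A+1)K) for K ≥ K₀(c,A).

DEFINITION REQUESTS. None needed to state the items (pencil determinant, root and alternation counts
are inlined over Mathlib: Matrix.det, Polynomial.roots,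
Matrix.IsSymm). Nice-to-have later (Literature/Computability/AlgebraicComplexity or Mathlib-side):
`lacunaryPencil S d`, `posRootCount`,
`signAlternations` with the merging/perturbation API, and a named fact for CameronPsarrakos2019 Thm
3.

Novelty: Searches (2026-08-17): lit search --source zbmath "Cameron Psarrakos Descartes rule of signs matrix
polynomials" (1: doi:10.7153/oam-2019-13-48, READ pp.2–7: Lemma 1/2, Thm 3, Ex. 5, conjecture (6));
lit search --source zbmath "real roots sparse polynomial symmetric matrix determinant number of
terms bound" (1, irrelevant: Breiding–Kohn–Sturmfels 2024); lit galaxy search --star all "Descartes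
rule of signs for matrix polynomials" (0), "real eigenvalues of self-adjoint matrix polynomials"
(0); lit galaxy search --star pdf --mode bm25 "number of real roots of sparse polynomial systems and
determinants of symmetric matrices with few monomials" (15: sparse resultants/Emiris, binomial
systems — none on lacunary symmetric determinants); lit frontier ValiantsHypothesis --since 2022
(25; nearest arXiv:2601.00387 "Exponential lower bound via exponential sums" = Shub–Smale τ via
parameterized classes, READ abstract — no real roots, no determinants); lit bridges
ValiantsHypothesis --cross any (12, surveys/books); local searchd down (rc ConnectionReset ×3),
openalex/s2 rate-limited (429) — recorded; plus the card's 2026-08-15/16 searches and the mechanism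
critic's zbMATH/galaxy audit (Cameron–Psarrakos the only matrix-Descartes text; 'real zeros
determinant sparse entries' 0). All 57 open theses of the sub read (current_theses.json) +
SymPencil/FeketeSOS/Newton*/TauConst/PolarDegree files grepped for wronsk|descartes|real root; 19
cards; 4 negatives; 8 corpses.
Nearest prior art found: C  [refs: 10.7153/oam-2019-13-48, 2601.00387, doi:10.7153/oam-2019-13-48, CameronPsarrakos2019, Koiran2011, KoiranPortierTavenas2015, Tavenas2014, GrenetEtAl2011]

Barriers (technique_class: real-root-counting, descartes-induction, spectral-pencils): - technique_class: real-root-counting, descartes-induction, spectral-pencils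
- Literature.Barriers.ValiantsHypothesis.TauRealZeros: evaded by the CLASS, not ignored: the
barrier's witnesses (Chebyshev T_{2^k} at τ = O(k), logistic/Dickson dilations) square intermediate
results; in the lacunary-symmetric-determinant class a 2-term pencil has ≤ m positive roots and
every skew realisation tried keeps size ≥ degree/K (sector (e)); whether T_{2^j} enters the class at
poly(j) size is exactly the Cheapest falsifier (i) — the bet is that it does not (skew circuits
cannot square values). Scope note (file CharacteristicTwo.lean, class CharacteristicFreePerNotVP):
the count uses the ORDER of ℝ, so the line is characteristic-0-specific by construction and asserts
nothing where per = det — consistent with that scope barrier, not an evasion claim.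
- Literature.Barriers.ValiantsHypothesis.AlgebraicNaturalProofs: outside the class as stated — "few
sign alternations on lacunary monomial curves in the qp regime" is a semialgebraic, archimedean,
exponent-size-driven property of the computed polynomial, not a poly-size polynomial equation
vanishing on coefficient vectors of VP_N (FSV Def. 1); the barrier is conditional (succinct hitting
sets) either way.
- Literature.Barriers.ValiantsHypothesis.MonotoneGap / RankMethods / RankLiftingBarrier /
PartialDerivativesDetPerm / ShiftedPartialDerivatives / DepthReductionChasm / FullRankMultilinear /
GCTOccurrenceObstructions / NotViaSaturations / Noncomm

History (route lifecycle, newest last):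
- 2026-08-17T08:09:28Z · BROKEN — DerivedPencilRolle (stmt-ValiantsHypothesis-18500, support) refuted by Summit.ValiantsHypothesis.ValiantsHypothesis.Theorems.SymmetroidDescartes.not_DerivedPencilRolle @ 6926a673794b (prover-line-stmt-ValiantsHypothesis-18500-0)
- 2026-08-17T09:16:07Z · rev 7: dropped stmt-ValiantsHypothesis-18500 — route-repair bookkeeping: re-assert the drop of the refuted DerivedPencilRolle (stmt-18500, already state=dropped since 08:30:16Z) so route_repair_prewrite arch (planner-rfix-ValiantsHypothesis-SymmetroidDe-fe519e7e-0)
- 2026-08-24T12:42:25Z · DORMANT — reconciler: no traction for 6.8 d (last activity item-evidence-added at 2026-08-17T17:28:16Z); parked, not closed — `ledger route dormant route-ValiantsHypothes (operator:999:2058186)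

sub-problem: ValiantsHypothesis · status: dormant · opened planner-plan-lens3-ValiantsHypothesis-strengthen-0 2026-08-17T02:39:40Z · rev 9 · ledger route-ValiantsHypothesis-SymmetroidDescartes
GENERATED by the gate from the ledger (D-0016/17). Provers cite these decls: `theorem foo : Summit.ValiantsHypothesis.ValiantsHypothesis.Theses.SymmetroidDescartes.<Decl> := …` in Summits/ValiantsHypothesis/ValiantsHypothesis/Theorems/<Name>.lean.
-/

namespace Summit.ValiantsHypothesis.ValiantsHypothesis.Theses.SymmetroidDescartes

open scoped BigOperators Topology Manifold Classical MeasureTheory ProbabilityTheory Matrix InnerProductSpace ComplexConjugate ContinuousMap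
open Filter Set Function TopologicalSpace MeasureTheory

attribute [summit_statement] _root_.ValiantsHypothesis

open Literature.PNP

/-- item stmt-ValiantsHypothesis-18064 · crux · rank 2 · open · by planner
why it might fail: A root-amplification mechanism in skew circuits over few lacunary monomials beyond tropical breakpoints (Gusfield-tight at 2^Θ(log² m)) — multi-scale bumps, or cancellation among signed paths — giving 2^((log m)^ω(1)) positive roots with Z₊(∂F)=0 (triangular class) kills it for every A.
sources: CameronPsarrakos2019, KoiranPortierTavenas2015, arXiv:1205.1015, GajjarRadhakrishnan2019, arXiv:1811.05115, MulmuleyShah2001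
[crux] REPAIRED INDUCTIVE STEP on the number of terms (K+1 → K), replacing DerivedPencilRolle
(refuted on paper 2026-08-17, kept as a negative edge): there are constants C, A such that for every
size m and every (K+1)-term pencil F = Σ_{l≤K} X^(d_l)•S_l (S_l real symmetric INVERTIBLE m×m, d
strictly increasing) Z₊(det F) ≤ C·Z₊(det ∂F) + (K+1)^(A·K)·2^((log₂ m+2)^A), ∂F =
Σ_{l≥1}(d_l−d₀)X^(d_l−d₀−1)•S_l the derived K-term pencil (same class). The budget is Descartes-like
in the NUMBER OF TERMS (K^(O(K))) times QUASI-POLYNOMIAL in the SIZE — the weakest natural slack the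
glue absorbs (in the regime log₂ m ≤ c(log₂K+1)² it is ≤ K^(O(K)); support QuasiRolleToDescartes)
and the shape the refutation of the old step forces: on the triangular/ABP class Z₊(∂F)=0 (tree
`triangular_bound_of_pencilBound`), while parametric-shortest-path DAGs with n^(Ω(log n))
breakpoints (Carstensen1983; MulmuleyShah2001; GajjarRadhakrishnan2019 Thm 1/Lemma 7) + the
convexity bump (tree `two_mul_le_card_posRoots_bumpPoly`) give 2^(Θ(log² m)) positive roots, and the
staircase family (Cruxes/DerivedPencilRolle/Lines/staircase-refutation.md) gives m^((K−1)/6) at K+1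
= O(1) terms — so every budget polynomial in m -/
@[route_item "route-ValiantsHypothesis-SymmetroidDescartes", crux]
def DerivedPencilRolleQuasi : Prop :=
  ∃ C A : ℕ, ∀ (m K : ℕ) (S : Fin (K + 1) → Matrix (Fin m) (Fin m) ℝ) (d : Fin (K + 1) → ℕ), (∀ l, (S l).IsSymm) → (∀ l, (S l).det ≠ 0) → StrictMono d → ((∑ l, (Polynomial.X : Polynomial ℝ) ^ d l • (S l).map Polynomial.C).det.roots.toFinset.filter (fun t => 0 < t)).card ≤ C * ((∑ l : Fin K, (Polynomial.X : Polynomial ℝ) ^ (d l.succ - d 0 - 1) • (((d l.succ - d 0 : ℕ) : ℝ) • S l.succ).map Polynomial.C).det.roots.toFinset.filter (fun t => 0 < t)).card + (K + 1) ^ (A * K) * 2 ^ (Nat.log 2 m + 2) ^ A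

/-- item stmt-ValiantsHypothesis-18501 · crux · rank 3 · open · by planner
why it might fail: Indefinite S_l may let an eigen-branch wind super-exponentially in K: T_{2^j}-like compositions as poly(j)-size poly(j)-term symmetric lacunary determinants WITHOUT size ≥ degree, or root amplification beyond tropical breakpoints iterated over K ≫ log m scales, would exceed K^(bK).
sources: CameronPsarrakos2019, Koiran2011, KoiranPortierTavenas2015, Khovanskii1991, GrenetEtAl2011, Tavenas2014
[crux] LACUNARY MATRIX DESCARTES RULE (card K1 in the form the assembly needs, alternation
currency): ∃ b ∀ c ∃ K₀ ∀ K ≥ K₀ ∀ m ≤ 2^(c(log₂K+1)²), for all real symmetric S_0..S_{K−1} (m×m)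
and exponents d : Fin K → ℕ, every strictly increasing positive sequence τ_0 < … < τ_N with det
F(τ_j)·det F(τ_{j+1}) < 0 for all j (F = Σ_l X^(d_l)•S_l) has N ≤ K^(bK). Trivial bound (Descartes
on ≤ C(m+K−1,K−1) monomials) is 2^(Θ(cK log²K)); commuting/definite/hyperbolic sectors give ≤
m(K−1). [deps: DerivedPencilRolle] [difficulty: open-problem] -/
@[route_item "route-ValiantsHypothesis-SymmetroidDescartes"]
def LacunaryDescartes : Prop :=
  ∃ b : ℕ, ∀ c : ℕ, ∃ K₀ : ℕ, ∀ K ≥ K₀, ∀ m : ℕ, m ≤ 2 ^ (c * (Nat.log 2 K + 1) ^ 2) → ∀ (S : Fin K → Matrix (Fin m) (Fin m) ℝ) (d : Fin K → ℕ), (∀ l, (S l).IsSymm) → ∀ (N : ℕ) (τ : Fin (N + 1) → ℝ), StrictMono τ → (∀ j, 0 < τ j) → (∀ j : Fin N, ((∑ l, (Polynomial.X : Polynomial ℝ) ^ d l • (S l).map Polynomial.C).det).eval (τ j.castSucc) * ((∑ l, (Polynomial.X : Polynomial ℝ) ^ d l • (S l).map Polynomial.C).det).eval (τ j.succ) < 0)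 → N ≤ K ^ (b * K)

/-- item stmt-ValiantsHypothesis-18065 · support · rank 9 · closed · proved by Summit.ValiantsHypothesis.ValiantsHypothesis.Theorems.SymmetroidDescartes.quasiRolleToDescartes_proof @ dfc95003dd45 (prover) · by planner
sources: Khovanskii1991, arXiv:1205.1015, CameronPsarrakos2019
[support] GLUE for the repaired engine (replaces RolleToDescartes 18503, whose proof
`rolleToDescartes_proof` is the template): DerivedPencilRolleQuasi → LacunaryDescartes. Iterate the
step K times (budget monotone in K; base: a one-term pencil has no positive root) to get Z₊ ≤
(K+1)·C'^K·(K+1)^(A·K)·2^((log₂m+2)^A), C' = max C 1, for invertible-coefficient strictly lacunary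
pencils (= `posRoots_le_of_derivedPencilRolle` with the new budget); merge equal exponents, perturb
S_l ↦ S_l + ηI off the spectra, IVT at the N+1 test points (verbatim
`alternations_le_of_derivedPencilRolle`); regime arithmetic replacing `regime_pow_le`: for m ≤
2^(c(log₂K+1)²), (log₂m+2)^A ≤ ((c+2)(log₂K+1)²)^A ≤ K for K ≥ K₀(c,A), hence 2^((log₂m+2)^A) ≤ 2^K
≤ K^K (K ≥ 2), (K+1)^(A·K) ≤ K^(2A·K), K·C'^K ≤ K^((C'+1)K): N ≤ K^(bK) with b = C' + 2A + 3 (b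
depends on C, A only, as `∃ b ∀ c` requires). [deps: DerivedPencilRolleQuasi] [difficulty: M] -/
@[route_item "route-ValiantsHypothesis-SymmetroidDescartes", crux]
def QuasiRolleToDescartes : Prop :=
  DerivedPencilRolleQuasi → LacunaryDescartes

/-- item stmt-ValiantsHypothesis-18502 · support · rank 9 · closed · proved by Summit.ValiantsHypothesis.ValiantsHypothesis.Theorems.SymmetroidDescartes.ThetaPencilWitness_proof @ 3ec9146481eb (prover) · by planner
sources: Tavenas2014, GrenetEtAl2011, HrubesYehudayoff2011, Burgisser2000, KoiranEtAl2014
[support] THETA MONSTER IN THE CLASS (card P1+P2; conditional construction, provable now from tree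
theorems): if PER is p-computable over ℂ then for every b there is c such that for every K₀ some K ≥
K₀ admits a K-term real symmetric pencil of size m ≤ 2^(c(log₂K+1)²) whose determinant has ≥
K^(bK)+1 strict sign alternations on (0,∞). Proof path: Tavenas2014 Cor. 3.37
(`Tavenas2014_cor_3_37`, discharged in TavenasVnWitness.lean: multilinear h_ν, a projection of
PER_q(ν), with h_ν(X^(2^j); 2^(2^i)) = V_ν) ⇒ group the bits j = βi+s into digits, Θ_ν(y) := h_ν(x_j
:= y_i^(2^s); z := 2^(2^i)) in n_y ≈ (2ν+3)/β variables, β = (2b+1)⌈log₂ν⌉+O(1) ⇒ Θ_ν = substitution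
instance of PER_q(ν) of poly cost (`complexity_aeval_le`) ⇒ p-computable over ℂ, real coefficients ⇒
over ℝ (`CommExtSim.complexity_lmap_le`, basis {1,i}) ⇒ affine det rep of size 2^(17E²),
E=(log₂ν+1)A (`determinantalComplexity_le_two_pow`) ⇒ symmetric of size 4m³+7
(`GKKP2011_detPoly_symmetric_holds ℝ`) ⇒ substitute y_0 := −t, y_i := t^(B^i): a pencil with K =
n_y+1 terms and det = V_ν(−t), whose signs at t_u = 4^(2u+1)/4^ν alternate (`sign_eval_xPt`) for u <
2^ν > K^(bK)+1. [difficulty: L] -/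
@[route_item "route-ValiantsHypothesis-SymmetroidDescartes", crux]
def ThetaPencilWitness : Prop :=
  Literature.Computability.AlgebraicComplexity.IsPComputable (fun n => Literature.Computability.AlgebraicComplexity.perPoly (Fin n) ℂ) → ∀ b : ℕ, ∃ c : ℕ, ∀ K₀ : ℕ, ∃ K ≥ K₀, ∃ m ≤ 2 ^ (c * (Nat.log 2 K + 1) ^ 2), ∃ (S : Fin K → Matrix (Fin m) (Fin m) ℝ) (d : Fin K → ℕ), (∀ l, (S l).IsSymm) ∧ ∃ τ : Fin (K ^ (b * K) + 1 + 1) → ℝ, StrictMono τ ∧ (∀ j, 0 < τ j) ∧ ∀ j : Fin (K ^ (b * K) + 1), ((∑ l, (Polynomial.X : Polynomial ℝ) ^ d l • (S l).map Polynomial.C).det).eval (τ j.castSucc) * ((∑ l, (Polynomial.X : Polynomial ℝ) ^ d l • (S l).map Polynomial.C).det).eval (τ j.succ) < 0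

-- earlier Assembly (stmt-ValiantsHypothesis-18504, replaced 2026-08-17T08:30:16Z -> stmt-ValiantsHypothesis-17906): proved by Summit.ValiantsHypothesis.ValiantsHypothesis.Theorems.SymmetroidDescartes.assembly_proof @ db1857a4a387 — DerivedPencilRolle → RolleToDescartes → ThetaPencilWitness → _root_.ValiantsHypothesis
/-- item stmt-ValiantsHypothesis-17906 · assembly · rank 1 · open · by planner
sources: Burgisser2000, Valiant1979, Tavenas2014
[assembly] rev-2 deciding chain, literally the type of `closes`: DerivedPencilRolleQuasi →
QuasiRolleToDescartes → ThetaPencilWitness → VP_ℂ ≠ VNP_ℂ (LacunaryDescartes derived inside as `h₂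
h₁`). Supersedes the rev-1 chain DerivedPencilRolle → RolleToDescartes → ThetaPencilWitness → VH
(stmt-18504, proved at db1857a4 against the rev-1 closes; its tree proof
`Theorems/SymmetroidDescartesAssembly.lean: assembly_proof := by unfold Assembly; intro h₁ h₂ h₃;
exact closes h₁ h₂ h₃` stopped elaborating when closes was re-glued at rev 2 and elaborates VERBATIM
against this statement — planner Sketch.lean rc 0). Provable now: `exact fun h₁ h₂ h₃ => closes h₁
h₂ h₃`, or close by `assembly_proof` once that module rebuilds. [difficulty: XS] -/
@[route_item "route-ValiantsHypothesis-SymmetroidDescartes"]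
def Assembly : Prop :=
  DerivedPencilRolleQuasi → QuasiRolleToDescartes → ThetaPencilWitness → _root_.ValiantsHypothesis

-- records of items no longer active in this route (dropped / restated):
-- earlier DerivedPencilRolle (stmt-ValiantsHypothesis-18500, dropped 2026-08-17T08:30:16Z): refuted by Summit.ValiantsHypothesis.ValiantsHypothesis.Theorems.SymmetroidDescartes.not_DerivedPencilRolle @ 6926a673794b — ∃ C a : ℕ, ∀ (m K : ℕ) (S : Fin (K + 1) → Matrix (Fin m) (Fin m) ℝ) (d : Fin (K + 1) → ℕ), (∀ l, (S l).IsSymm) → (∀ l, (S l).det ≠ 0) → StrictMono d → ((∑ l, (Polynomial.X : Polynomial 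
-- earlier RolleToDescartes (stmt-ValiantsHypothesis-18503, dropped 2026-08-17T08:30:16Z): proved by Summit.ValiantsHypothesis.ValiantsHypothesis.Theorems.SymmetroidDescartes.rolleToDescartes_proof @ 514c2ecd3a9b — DerivedPencilRolle → LacunaryDescartes

/-! D-0027 §2.1 — DECIDING THEOREM (planner-authored via `route open/edit --closes-file`; by planner-rchoice-ValiantsHypothesis-SymmetroidD-1734c3fd-0 2026-08-17T07:44:19Z):
its hypotheses are this route's items and its conclusion the sub-problem Statement (glue_lint), and it elaborates with this file. -/

/-! D-0027 §2.1 deciding theorem for route SymmetroidDescartes, rev 2 (route-choice 2026-08-17: the rank-2 engine RESTATED).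
Shape unchanged (strengthen-to-induct): the INDUCTIVE STEP on the number of terms is the crux hypothesis — now
`DerivedPencilRolleQuasi` (budget `(K+1)^(A·K) · 2^((log₂ m+2)^A)`; the polynomial-budget `DerivedPencilRolle` is refuted on
paper by the triangular/ABP class and kept only as a negative edge); the strengthened statement X = `LacunaryDescartes` is
derived in-cone through the glue support `QuasiRolleToDescartes`; the theta-monster support `ThetaPencilWitness` (proved)
decides `VP_ℂ ≠ VNP_ℂ` by inversion through `perNotPComputableComplex_iff_holds`; pure logic + `omega`. -/
@[closes "route-ValiantsHypothesis-SymmetroidDescartes"] theorem closes (h₁ : DerivedPencilRolleQuasi) (h₂ : QuasiRolleToDescartes) (h₃ : ThetaPencilWitness) : _root_.ValiantsHypothesis := by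
  -- the repaired inductive step, iterated and perturbed (glue), gives the matrix Descartes rule X
  have hX : LacunaryDescartes := h₂ h₁
  unfold ValiantsHypothesis Literature.PNP.ValiantHypothesis
  rw [← Literature.Computability.AlgebraicComplexity.perNotPComputableComplex_iff_holds]
  intro hper
  obtain ⟨b, hb⟩ := hX
  obtain ⟨c, hc⟩ := h₃ hper b
  obtain ⟨K₀, hK₀⟩ := hb c
  obtain ⟨K, hK, m, hm, S, d, hS, τ, hτ, hpos, halt⟩ := hc K₀
  have h := hK₀ K hK m hm S d hS (K ^ (b * K) + 1) τ hτ hpos halt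
  omega

end Summit.ValiantsHypothesis.ValiantsHypothesis.Theses.SymmetroidDescartes
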